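import Literature.NumberTheory.Sieve.CircleMethodMajorArcsPrimePairProofs
import HarnessLib

/-!
# Classical major arcs for prime pairs: levels `P = (log N)^{B'}`, `Q = (log N)^B`, sum over `[1, N]`

Topic `Literature/NumberTheory/Sieve`, companion of `CircleMethodMajorArcsPrimePairProofs.lean`
(Matomäki–Radziwiłł–Tao 2019, Prop. 3.3(i): the *dyadic* sum `S_{Λ1_{(X,2X]}}` on the arcs
`𝔐_{log^B X, X^{-1} log^{B'} X}` with `B' ≥ 2B + A`, error `O(d₂(h)^{O(1)} X log^{-A} X)`).
The circle method as set up in the tree's prelude `Literature/NumberTheory/Sieve/CircleMethod.lean`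
(and as used by route `Parity/BatemanHorn/MinorArcs`) works instead with the *full* sum
`S(α) = S_{Λ1_{[1,N]}}(α) = ∑_{n ≤ N} Λ(n) e(nα)` (`Literature.primeExpSum N`) and the arcs
`𝔐 = Literature.majorArcs N P Q` of level `P = Q = (log N)^B` (Vaughan, *The Hardy–Littlewood Method*,
§3.1; Nathanson, GTM 164, §8.3). This file proves the corresponding **classical major-arc
evaluation for prime pairs**, by the same routine computation (MRT pp. 20–21 run with
`(X, 2X] ↦ [1, N]` and without the constraint `B' ≥ 2B + A`, which only serves the log-power
bookkeeping there):

* `primePairMajorArcs_logPow_of_prop41` — assuming `Literature.NumberTheory.Sieve.MatomakiRadziwillTao2019_prop41`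
  (MRT Prop. 4.1, itself reduced to the Siegel–Walfisz theorem in
  `CircleMethodMajorArcsProofs.lean`): for `B, B' > 0` there are `N₀`, `C` with
  `|∫_{𝔐(N; log^{B'} N, log^B N)} |S(α)|² e(αh) dα − 𝔖(h) N|
     ≤ C d(h)² (N ((log N)^{-B/2} + (log N)^{-B'}) + |h|)`
  for all `N ≥ N₀` and `0 < |h| ≤ N`; here `𝔖(h) = Literature.goldbachSingularSeries |h|` (MRT eq. (7))
  and `d(h)` is the number of divisors of `|h|`. The three error terms are: the tail
  `∑_{q > Q} μ²(q)c_q(h)/φ²(q) ≪ d(h)² Q^{-1/2}` of the singular series, the truncation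
  `∫_{|β| > P/N} |T(β)|² ≪ N/P` of the kernel integral, and the shift `|h|` in
  `∫_𝕋 |T(β)|² e(βh) dβ = N − |h|` (`T(β) = ∑_{n ≤ N} e(nβ)`); the arc-by-arc error of
  Prop. 4.1 is `O_B(N (log N)^{-B})`.
* `primePairMajorArcs_classical_of_prop41` — the case `P = Q = (log N)^B`:
  error `C d(h)² (N (log N)^{-B/2} + |h|)`.
* `primePairMajorArcs_classical_eps_of_prop41` — the qualitative form used by the route item
  `MinorarcsTwinMajor` (there with `h = −2`, `𝔖({0,2}) = 𝔖(2)` by `Literature.NumberTheory.Sieve.singularSeries_pair_holds`,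
  `Literature.goldbachSingularSeries_two`): for fixed `h ≠ 0`, `B > 0`, `ε > 0` and all large `N`,
  `|∫_𝔐 |S(α)|² e(αh) dα − 𝔖(h) N| ≤ ε N`; and `…_eps_conj_of_prop41`, the same with the
  integrand written `S(α) conj(S(α)) e(αh)`.
* `…_of_siegelWalfisz` — the same statements from `Literature.NumberTheory.Sieve.siegel_walfisz` (parity.S28),
  via `Literature.NumberTheory.Sieve.MatomakiRadziwillTao2019_prop41_of_siegelWalfisz`.

## Structure

The geometry of the arcs (disjointness for `2PQ² < N`, decomposition of `∫_𝔐`, translation of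
an arc to `[-δ, δ]`, the two half-arcs at `0/1` and `1/1`) is imported from
`CircleMethodMajorArcsPrimePairProofs.lean` (namespace `Literature.PrimePairMajorArcs`); the kernel
facts for `T_{0,N} = Literature.expSumIoc 0 N` (`= Literature.linearExpSum N`, `expSumIoc_zero_natCast`) from
`CircleMethodKernel.lean`; the Ramanujan-sum evaluation `∑_{(a,q)=1} e(ah/q) = c_q(h)` and the
singular series `∑_q μ²(q)c_q(h)/φ²(q) = 𝔖(h)` with its tail from `RamanujanSum.lean`,
`GoldbachSingularSeriesSum.lean`; and the passage from the integral kernel `∫_1^N e(βx) dx` of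
Prop. 4.1 to `T_{0,N}(β)` (`|∑_{n ≤ N} e(nβ) − ∫_1^N e(βx)dx| ≤ 1 + 2π|β|N`) from
`CircleMethodMajorArcsProofs.lean`. What is redone here (namespace
`Literature.PrimePairMajorArcsClassical`) is the part of the MRT computation that mentions the sum: the
arc models `kernelArcModel u v h q a` and their evaluation `sum_integral_kernelArcModel`
(`∑_{(a,q)=1} ∫_{𝔐(q,a)} model = μ²(q)c_q(h)/φ²(q) · ∫_{-δ}^{δ} |T_{u,v}|² e(βh)`), now stated for
the kernel `T_{u,v}` of an arbitrary integer interval `(u, v]` (the dyadic lemmas of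
`Literature.PrimePairMajorArcs` being the case `(X, 2X]`, the present file using `(0, N]`); the integrand
`|S|² e(αh)`; the pointwise approximation `|S(a/q + β)|² = μ²(q)/φ²(q) |T_{0,N}(β)|² + O(N² log^{-A'} N)`
from Prop. 4.1; the summed error; and the final bookkeeping. No new named facts; axioms `propext`,
`Classical.choice`, `Quot.sound` only.

## References

* K. Matomäki, M. Radziwiłł, T. Tao, *Correlations of the von Mangoldt and higher divisor
  functions I. Long shift ranges*, Proc. LMS 118 (2019) 284–350, arXiv:1707.01315: Prop. 4.1
  p. 20, proof of Prop. 3.3(i) pp. 20–21 (arXiv pagination). [MatomakiRadziwillTao2019]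
* R. C. Vaughan, *The Hardy–Littlewood Method*, 2nd ed. (1997), §3.1–3.2 (arcs of level
  `P = Q = (log N)^B`, the kernel `T(β)`). [VaughanHL1997]
* M. B. Nathanson, *Additive Number Theory: The Classical Bases*, GTM 164 (1996), §8.3–8.4
  (major arcs `|α − a/q| ≤ Q/N`, `Q = (log N)^B`). [Nathanson1996]
-/

noncomputable section

open scoped FourierTransform ArithmeticFunction.Moebius ArithmeticFunction
open Finset MeasureTheory ArithmeticFunction

namespace Literature.NumberTheory.Sieve

open CircleMethodKernel PrimePairMajorArcs

namespace PrimePairMajorArcsClassical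

/-! ### The integrand `|S(α)|² e(αh)` and its arc models -/

/-- The prime-pair integrand `|S_{Λ1_{[1,N]}}(α)|² e(αh)` with the full sum `S = Literature.primeExpSum N`
(the integrand of MRT Prop. 3.3(i), `Literature.NumberTheory.Sieve.PrimePairMajorArcs.hlIntegrand`, with `[1, N]` in place of
`(X, 2X]`). [folklore] -/
def pairIntegrand (N : ℕ) (h : ℤ) (α : ℝ) : ℂ :=
  ((‖primeExpSum N α‖ ^ 2 : ℝ) : ℂ) * (𝐞 (α * h) : ℂ)

/-- Unfolding lemma for `pairIntegrand`. [folklore] -/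
theorem pairIntegrand_apply (N : ℕ) (h : ℤ) (α : ℝ) :
    pairIntegrand N h α = ((‖primeExpSum N α‖ ^ 2 : ℝ) : ℂ) * (𝐞 (α * h) : ℂ) := rfl

/-- The integrand is continuous. [folklore] -/
@[fun_prop]
theorem continuous_pairIntegrand (N : ℕ) (h : ℤ) : Continuous (pairIntegrand N h) := by
  unfold pairIntegrand; fun_prop

/-- `|integrand| = |S(α)|²`. [folklore] -/
theorem norm_pairIntegrand (N : ℕ) (h : ℤ) (α : ℝ) :
    ‖pairIntegrand N h α‖ = ‖primeExpSum N α‖ ^ 2 := by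
  rw [pairIntegrand_apply, norm_mul, Circle.norm_coe, mul_one, Complex.norm_real, Real.norm_eq_abs,
    abs_of_nonneg (sq_nonneg _)]

/-- `S(α) · conj S(α) = |S(α)|²` (as a complex number). [folklore] -/
theorem primeExpSum_mul_conj (N : ℕ) (α : ℝ) :
    primeExpSum N α * (starRingEnd ℂ) (primeExpSum N α) = ((‖primeExpSum N α‖ ^ 2 : ℝ) : ℂ) := by
  rw [Complex.mul_conj, Complex.normSq_eq_norm_sq]

/-- Trivial bound `|S(α)| ≤ ψ(N) ≤ (log 4 + 4) N`. [folklore] -/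
theorem norm_primeExpSum_le_mul (N : ℕ) (α : ℝ) : ‖primeExpSum N α‖ ≤ (Real.log 4 + 4) * N :=
  (norm_primeExpSum_le_psi N α).trans (Chebyshev.psi_le_const_mul_self (by positivity))

/-- The model of a prime-pair integrand on the arc `𝔐(q, a)`, for the kernel of an arbitrary
integer interval `(u, v]`:
`(μ(q)/φ(q))² e(ah/q) |T_{u,v}(α - a/q)|² e((α - a/q)h)`, `T_{u,v} = Literature.expSumIoc u v`. For
`(u, v] = (X, 2X]` this is `Literature.NumberTheory.Sieve.PrimePairMajorArcs.arcModel` (MRT's dyadic setting); below it is used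
with `(u, v] = (0, N]`. [cite: MatomakiRadziwillTao2019, §4, p. 20 (arXiv)] -/
def kernelArcModel (u v h : ℤ) (q a : ℕ) (α : ℝ) : ℂ :=
  ((((μ q : ℝ) / (Nat.totient q : ℝ)) ^ 2 : ℝ) : ℂ) * (𝐞 ((a : ℝ) * h / q) : ℂ) *
    expSumIocSqKernel u v h (α - a / q)

/-- Unfolding lemma for `kernelArcModel`. [folklore] -/
theorem kernelArcModel_apply (u v h : ℤ) (q a : ℕ) (α : ℝ) :
    kernelArcModel u v h q a α = ((((μ q : ℝ) / (Nat.totient q : ℝ)) ^ 2 : ℝ) : ℂ) *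
      (𝐞 ((a : ℝ) * h / q) : ℂ) * expSumIocSqKernel u v h (α - a / q) := rfl

/-- The model is continuous. [folklore] -/
@[fun_prop]
theorem continuous_kernelArcModel (u v h : ℤ) (q a : ℕ) : Continuous (kernelArcModel u v h q a) := by
  unfold kernelArcModel; fun_prop

/-- The model rewritten with the phase `e(αh)`:
`kernelArcModel = (μ/φ)² |T_{u,v}(α - a/q)|² e(αh)`. [folklore] -/
theorem kernelArcModel_eq (u v h : ℤ) (q a : ℕ) (α : ℝ) :
    kernelArcModel u v h q a α = ((((μ q : ℝ) / (Nat.totient q : ℝ)) ^ 2 *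
      ‖expSumIoc u v (α - a / q)‖ ^ 2 : ℝ) : ℂ) * (𝐞 (α * h) : ℂ) := by
  rw [kernelArcModel_apply, expSumIocSqKernel_apply, mul_assoc,
    mul_left_comm (𝐞 ((a : ℝ) * h / q) : ℂ), fourierChar_coe_mul, ← mul_assoc, ← Complex.ofReal_mul]
  congr 3
  ring

/-- Integrand minus model on an arc: `(|S(α)|² - (μ/φ)²|T_{0,N}(α - a/q)|²) e(αh)`, of norm
`| |S(α)|² - (μ/φ)²|T_{0,N}(α-a/q)|² |`. [folklore] -/
theorem norm_pairIntegrand_sub_kernelArcModel (N : ℕ) (h : ℤ) (q a : ℕ) (α : ℝ) :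
    ‖pairIntegrand N h α - kernelArcModel 0 N h q a α‖ =
      |‖primeExpSum N α‖ ^ 2 -
        ((μ q : ℝ) / (Nat.totient q : ℝ)) ^ 2 * ‖expSumIoc 0 N (α - a / q)‖ ^ 2| := by
  rw [pairIntegrand_apply, kernelArcModel_eq, ← sub_mul, norm_mul, Circle.norm_coe, mul_one,
    ← Complex.ofReal_sub, Complex.norm_real, Real.norm_eq_abs]

/-! ### Main term on the arcs around `a/q`, summed over `a` -/

/-- The truncated kernel integral `I_δ = ∫_{-δ}^{δ} |T_{u,v}(β)|² e(βh) dβ` of an integer interval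
`(u, v]` (for `(X, 2X]` this is `Literature.NumberTheory.Sieve.PrimePairMajorArcs.kernelIntegral`). [folklore] -/
def truncatedKernelIntegral (u v h : ℤ) (δ : ℝ) : ℂ :=
  ∫ β in (-δ)..δ, expSumIocSqKernel u v h β

/-- **Main term over the arcs at denominator `q`**, for the kernel of any integer interval `(u, v]`:
for `1 ≤ q`, `0 ≤ δ = P/N ≤ min(1, 1/q)`,
`∑_{a : (a,q)=1} ∫_{𝔐(q,a)} kernelArcModel = g_{|h|}(q) · I_δ` with `g` the Ramanujan-series term
`μ²(q) c_q(h)/φ(q)²` (for `q = 1` the two half-arcs at `0` and `1` combine by periodicity). This is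
`Literature.NumberTheory.Sieve.PrimePairMajorArcs.sum_integral_arcModel` with the dyadic kernel `T_{X,2X}` replaced by `T_{u,v}`
(same proof). [cite: MatomakiRadziwillTao2019, §4, pp. 20–21 (arXiv)] -/
theorem sum_integral_kernelArcModel {N : ℕ} {P : ℝ} (u v h : ℤ) {q : ℕ} (hq : 1 ≤ q)
    (hP : 0 ≤ P / N) (hδ1 : P / N ≤ 1) (hδq : P / N ≤ 1 / q) :
    ∑ a ∈ (range (q + 1)).filter (fun a : ℕ ↦ a.Coprime q),
        ∫ α in majorArc N q (a : ℤ) P, kernelArcModel u v h q a α =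
      ((goldbachSeriesTerm h.natAbs q : ℝ) : ℂ) * truncatedKernelIntegral u v h (P / N) := by
  have hcoef : ∀ q : ℕ, ((((μ q : ℝ) / (Nat.totient q : ℝ)) ^ 2 : ℝ) : ℂ) * ramanujanSum q h =
      ((goldbachSeriesTerm h.natAbs q : ℝ) : ℂ) := by
    intro q
    rw [ramanujanSum_eq_ramanujanDivisorSum, goldbachSeriesTerm_apply]
    push_cast
    ring
  rcases Nat.lt_or_ge q 2 with hq1 | hq2
  · -- `q = 1`: arcs `[0, δ]` and `[1 - δ, 1]`
    obtain rfl : q = 1 := by omega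
    have hset : (range (1 + 1)).filter (fun a : ℕ ↦ a.Coprime 1) = {0, 1} := by decide
    rw [hset, sum_pair (by norm_num), ← hcoef 1, ramanujanSum_one, mul_one]
    have hmodel0 : kernelArcModel u v h 1 0 = fun α ↦ expSumIocSqKernel u v h α := by
      funext α; simp [kernelArcModel_apply]
    have hmodel1 : kernelArcModel u v h 1 1 = fun α ↦ expSumIocSqKernel u v h (α - 1) := by
      funext α
      rw [kernelArcModel_apply]
      simp [RamanujanSum.fourierChar_intCast]
    have hper : Function.Periodic (fun α : ℝ ↦ expSumIocSqKernel u v h (α - 1)) 1 := by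
      intro α; simp only [add_sub_cancel_right]
      have := periodic_expSumIocSqKernel u v h (α - 1)
      rwa [sub_add_cancel] at this
    rw [hmodel0, hmodel1, Nat.cast_zero, integral_majorArc_zero hP hδ1, Nat.cast_one,
      integral_majorArc_one_one hP hδ1 hper]
    have hshift : ∫ β in (-(P / N))..0, expSumIocSqKernel u v h (β - 1) =
        ∫ β in (-(P / N))..0, expSumIocSqKernel u v h β := by
      refine intervalIntegral.integral_congr fun β _ ↦ ?_
      have := periodic_expSumIocSqKernel u v h (β - 1)
      rw [sub_add_cancel] at this
      exact this.symm
    rw [hshift, truncatedKernelIntegral]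
    have hii : ∀ x y : ℝ, IntervalIntegrable (expSumIocSqKernel u v h) volume x y :=
      fun x y ↦ (continuous_expSumIocSqKernel _ _ _).intervalIntegrable _ _
    have h11 : ((((μ 1 : ℝ) / (Nat.totient 1 : ℝ)) ^ 2 : ℝ) : ℂ) = 1 := by
      rw [ArithmeticFunction.moebius_apply_one, Nat.totient_one]; norm_num
    rw [h11, one_mul, add_comm,
      intervalIntegral.integral_add_adjacent_intervals (hii _ _) (hii _ _)]
  · -- `q ≥ 2`: all arcs are interior
    rw [filter_coprime_range_succ hq2, ← hcoef q, ramanujanSum, mul_sum, sum_mul]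
    refine sum_congr rfl fun a ha ↦ ?_
    obtain ⟨haq, hcop⟩ := mem_filter.mp ha
    rw [mem_range] at haq
    have ha0 : a ≠ 0 := by
      rintro rfl
      rw [Nat.coprime_zero_left] at hcop
      omega
    have hq0 : 0 < q := by omega
    rw [integral_majorArc_interior hq0 (by exact_mod_cast Nat.pos_of_ne_zero ha0)
      (by exact_mod_cast haq) hP hδq]
    have hmodel : ∀ β : ℝ, kernelArcModel u v h q a (((a : ℤ) : ℝ) / q + β) =
        ((((μ q : ℝ) / (Nat.totient q : ℝ)) ^ 2 : ℝ) : ℂ) * (𝐞 ((a : ℝ) * h / q) : ℂ) *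
          expSumIocSqKernel u v h β := by
      intro β
      rw [kernelArcModel_apply]
      congr 2
      push_cast
      ring
    simp_rw [hmodel, intervalIntegral.integral_const_mul, truncatedKernelIntegral]

/-! ### From Prop. 4.1 to the sum-kernel approximation of `S` on an arc -/

/-- `T_{0,N}(β) = ∑_{n=1}^{N} e(nβ)` in the form of `CircleMethodMajorArcsProofs.lean`. [folklore] -/
theorem expSumIoc_zero_eq_sum_Icc (N : ℕ) (β : ℝ) :
    expSumIoc 0 N β = ∑ n ∈ Icc 1 N, (𝐞 (n * β) : ℂ) := by
  rw [expSumIoc_zero_natCast, linearExpSum]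

/-- **Prop. 4.1 ⇒ sum-kernel form on `[1, N]`.** Assuming `MatomakiRadziwillTao2019_prop41`: for
`A', B, B' > 0` there is `C` with
`|S(a/q + β) - (μ(q)/φ(q)) T_{0,N}(β)| ≤ C N log^{-A'} N`
for all `N ≥ 2`, `1 ≤ q ≤ log^B N`, `(a,q) = 1`, `|β| ≤ log^{B'} N / N`: the integral kernel
`∫_1^N e(βx) dx` of Prop. 4.1 is replaced by the sum `T_{0,N}(β)` at cost `1 + 2π|β|N ≤ 1 + 2π log^{B'} N`
(`Literature.NumberTheory.Sieve.CircleMethodMajorArcs.norm_sum_fourierChar_sub_integral_le`).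
[cite: MatomakiRadziwillTao2019, Prop. 4.1, p. 20 (arXiv)] -/
theorem primeExpSum_approx (h41 : MatomakiRadziwillTao2019_prop41) {A' B B' : ℝ}
    (hA' : 0 < A') (hB : 0 < B) (hB' : 0 < B') :
    ∃ C : ℝ, ∀ N : ℕ, 2 ≤ N → ∀ q : ℕ, 1 ≤ q → (q : ℝ) ≤ Real.log N ^ B →
      ∀ a : ℤ, Int.gcd a q = 1 → ∀ β : ℝ, |β| ≤ Real.log N ^ B' / N →
        ‖primeExpSum N (a / q + β) -
            ((μ q : ℝ) / (Nat.totient q : ℝ) : ℂ) * expSumIoc 0 N β‖ ≤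
          C * N * Real.log N ^ (-A') := by
  obtain ⟨C₂, hC₂⟩ := h41 A' B B' hA' hB hB'
  obtain ⟨K₁, hK₁, hK₁le⟩ := exists_log_rpow_le_rpow (k := A') hA' one_pos
  obtain ⟨K₂, hK₂, hK₂le⟩ := exists_log_rpow_le_rpow (k := A' + B') (by linarith) one_pos
  refine ⟨|C₂| + K₁ + 2 * Real.pi * K₂, fun N hN q hq hqB a ha β hβ ↦ ?_⟩
  -- basic quantities
  have hN0 : (0 : ℝ) < N := by exact_mod_cast (by omega : 0 < N)
  have hN1 : (1 : ℝ) ≤ N := by exact_mod_cast (by omega : 1 ≤ N)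
  set L := Real.log N with hL
  have hL0 : 0 < L := Real.log_pos (by exact_mod_cast (by omega : 1 < N))
  have hLA0 : 0 < L ^ (-A') := Real.rpow_pos_of_pos hL0 _
  -- Prop 4.1 at `N`
  have h1 : ‖primeExpSum N (a / q + β) - ((μ q : ℝ) / (Nat.totient q : ℝ) : ℂ) *
      ∫ x in (1 : ℝ)..(N : ℝ), (𝐞 (β * x) : ℂ)‖ ≤ |C₂| * N * L ^ (-A') := by
    refine (hC₂ N hN q hq hqB a ha β hβ).trans ?_
    exact mul_le_mul_of_nonneg_right (mul_le_mul_of_nonneg_right (le_abs_self _) hN0.le) hLA0.le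
  -- the kernel: `|T_{0,N}(β) - ∫_1^N e(βx) dx| ≤ 1 + 2π|β|N ≤ (K₁ + 2πK₂) N L^{-A'}`
  have hone : (1 : ℝ) ≤ K₁ * N * L ^ (-A') := by
    have h1' : L ^ A' ≤ K₁ * (N : ℝ) ^ (1 : ℝ) := hK₁le N hN1
    rw [Real.rpow_one] at h1'
    have hLApos : 0 < L ^ A' := Real.rpow_pos_of_pos hL0 _
    calc (1 : ℝ) = L ^ A' * L ^ (-A') := by
          rw [← Real.rpow_add hL0, add_neg_cancel, Real.rpow_zero]
      _ ≤ K₁ * N * L ^ (-A') := mul_le_mul_of_nonneg_right h1' hLA0.le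
  have hLB : L ^ B' ≤ K₂ * N * L ^ (-A') := by
    have h1' : L ^ (A' + B') ≤ K₂ * (N : ℝ) ^ (1 : ℝ) := hK₂le N hN1
    rw [Real.rpow_one] at h1'
    calc L ^ B' = L ^ (A' + B') * L ^ (-A') := by
          rw [← Real.rpow_add hL0]; ring_nf
      _ ≤ K₂ * N * L ^ (-A') := mul_le_mul_of_nonneg_right h1' hLA0.le
  have hkernel : ‖(∫ x in (1 : ℝ)..(N : ℝ), (𝐞 (β * x) : ℂ)) - expSumIoc 0 N β‖ ≤
      (K₁ + 2 * Real.pi * K₂) * N * L ^ (-A') := by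
    rw [norm_sub_rev, expSumIoc_zero_eq_sum_Icc]
    refine (CircleMethodMajorArcs.norm_sum_fourierChar_sub_integral_le β (by omega : 1 ≤ N)).trans ?_
    have hβN : |β| * N ≤ L ^ B' := by
      calc |β| * N ≤ L ^ B' / N * N := by gcongr
        _ = L ^ B' := div_mul_cancel₀ _ hN0.ne'
    calc 1 + 2 * Real.pi * |β| * N = 1 + 2 * Real.pi * (|β| * N) := by ring
      _ ≤ K₁ * N * L ^ (-A') + 2 * Real.pi * (K₂ * N * L ^ (-A')) :=
          add_le_add hone (mul_le_mul_of_nonneg_left (hβN.trans hLB) (by positivity))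
      _ = (K₁ + 2 * Real.pi * K₂) * N * L ^ (-A') := by ring
  -- assemble
  have hμ := norm_moebius_div_totient_le q
  set m : ℂ := ((μ q : ℝ) / (Nat.totient q : ℝ) : ℂ) with hm
  set I1 := ∫ x in (1 : ℝ)..(N : ℝ), (𝐞 (β * x) : ℂ)
  have hdecomp : primeExpSum N (a / q + β) - m * expSumIoc 0 N β =
      (primeExpSum N (a / q + β) - m * I1) + m * (I1 - expSumIoc 0 N β) := by ring
  rw [hdecomp]
  calc ‖(primeExpSum N (a / q + β) - m * I1) + m * (I1 - expSumIoc 0 N β)‖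
      ≤ ‖primeExpSum N (a / q + β) - m * I1‖ + ‖m‖ * ‖I1 - expSumIoc 0 N β‖ := by
        refine (norm_add_le _ _).trans (add_le_add le_rfl ?_)
        rw [norm_mul]
    _ ≤ |C₂| * N * L ^ (-A') + 1 * ((K₁ + 2 * Real.pi * K₂) * N * L ^ (-A')) := by
        gcongr
    _ = (|C₂| + K₁ + 2 * Real.pi * K₂) * N * L ^ (-A') := by ring

/-- **Pointwise major-arc approximation of `|S|²`** on `[1, N]`. Under Prop. 4.1: for `A', B, B' > 0`
there is `C` with `| |S(a/q+β)|² - (μ(q)²/φ(q)²)|T_{0,N}(β)|² | ≤ C N² log^{-A'} N` on every major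
arc (`N ≥ 2`), from `primeExpSum_approx` and the crude bounds `|S| ≤ (log 4 + 4)N`, `|T| ≤ N`
(cf. MRT p. 20: "From Proposition 4.1 and the crude bound `S(α) ≪ X` …").
[cite: MatomakiRadziwillTao2019, §4, p. 20 (arXiv)] -/
theorem normSq_primeExpSum_approx (h41 : MatomakiRadziwillTao2019_prop41) {A' B B' : ℝ}
    (hA' : 0 < A') (hB : 0 < B) (hB' : 0 < B') :
    ∃ C : ℝ, ∀ N : ℕ, 2 ≤ N → ∀ q : ℕ, 1 ≤ q → (q : ℝ) ≤ Real.log N ^ B →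
      ∀ a : ℤ, Int.gcd a q = 1 → ∀ β : ℝ, |β| ≤ Real.log N ^ B' / N →
        |‖primeExpSum N (a / q + β)‖ ^ 2 -
            ((μ q : ℝ) / (Nat.totient q : ℝ)) ^ 2 * ‖expSumIoc 0 N β‖ ^ 2| ≤
          C * N ^ 2 * Real.log N ^ (-A') := by
  obtain ⟨C, hC⟩ := primeExpSum_approx h41 hA' hB hB'
  refine ⟨C * ((Real.log 4 + 4) + 1), fun N hN q hq hqB a ha β hβ ↦ ?_⟩
  have h := hC N hN q hq hqB a ha β hβ
  set S := primeExpSum N (a / q + β)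
  set m : ℂ := ((μ q : ℝ) / (Nat.totient q : ℝ) : ℂ)
  set T := expSumIoc 0 N β
  have hN0 : (0 : ℝ) ≤ N := by positivity
  have hm : ‖m‖ ≤ 1 := norm_moebius_div_totient_le q
  have hT : ‖T‖ ≤ N := by
    have := norm_expSumIoc_le_card (a := (0 : ℤ)) (b := (N : ℤ)) (by omega) β
    push_cast at this
    linarith
  have hS : ‖S‖ ≤ (Real.log 4 + 4) * N := norm_primeExpSum_le_mul N _
  have hmT : ‖m * T‖ ≤ N := by
    rw [norm_mul]
    calc ‖m‖ * ‖T‖ ≤ 1 * N := by gcongr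
      _ = N := one_mul _
  have hsq : ((μ q : ℝ) / (Nat.totient q : ℝ)) ^ 2 * ‖T‖ ^ 2 = ‖m * T‖ ^ 2 := by
    rw [norm_mul, mul_pow, norm_div, Complex.norm_real, Complex.norm_real, Real.norm_eq_abs,
      Real.norm_eq_abs, ← abs_div, sq_abs]
  rw [hsq, sq_sub_sq, abs_mul]
  have hC0 : 0 ≤ C * N * Real.log N ^ (-A') := le_trans (norm_nonneg _) h
  calc |‖S‖ + ‖m * T‖| * |‖S‖ - ‖m * T‖|
      ≤ ((Real.log 4 + 4) * N + N) * (C * N * Real.log N ^ (-A')) := by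
        refine mul_le_mul ?_ ((abs_norm_sub_norm_le _ _).trans h) (abs_nonneg _) (by positivity)
        rw [abs_of_nonneg (by positivity)]
        exact add_le_add hS hmT
    _ = C * ((Real.log 4 + 4) + 1) * N ^ 2 * Real.log N ^ (-A') := by ring

/-! ### Error of the arc models, summed over all arcs -/

/-- **Major arcs = main term + error** on `[1, N]` (the `[1,N]`-analogue of
`Literature.NumberTheory.Sieve.PrimePairMajorArcs.integral_majorArcs_hlIntegrand_approx`): under Prop. 4.1, for `A', B, B' > 0`
there is `C` such that for `N ≥ 2` with `Q = log^B N ≥ 1`, `P = log^{B'} N`, `2PQ² < N`, `P/N ≤ 1/Q`,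
and every `h`,
`|∫_𝔐 |S|² e(αh) dα - (∑_{q ≤ Q} μ²(q)c_q(h)/φ²(q)) · I_{P/N}(h)| ≤ C N² log^{-A'} N · Q² · P/N`.
[cite: MatomakiRadziwillTao2019, §4, p. 20 (arXiv)] -/
theorem integral_majorArcs_pairIntegrand_approx (h41 : MatomakiRadziwillTao2019_prop41)
    {A' B B' : ℝ} (hA' : 0 < A') (hB : 0 < B) (hB' : 0 < B') :
    ∃ C : ℝ, 0 ≤ C ∧ ∀ N : ℕ, 2 ≤ N → 1 ≤ Real.log N ^ B →
      2 * Real.log N ^ B' * (Real.log N ^ B) ^ 2 < N →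
      Real.log N ^ B' / N ≤ 1 / Real.log N ^ B → ∀ h : ℤ,
        ‖(∫ α in majorArcs N (Real.log N ^ B') (Real.log N ^ B), pairIntegrand N h α) -
            (∑ q ∈ Icc 1 ⌊Real.log N ^ B⌋₊, ((goldbachSeriesTerm h.natAbs q : ℝ) : ℂ)) *
              truncatedKernelIntegral 0 N h (Real.log N ^ B' / N)‖ ≤
          C * N ^ 2 * Real.log N ^ (-A') * ((Real.log N ^ B) ^ 2 * (Real.log N ^ B' / N)) := by
  obtain ⟨C₃, hC₃⟩ := normSq_primeExpSum_approx h41 hA' hB hB'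
  refine ⟨4 * |C₃|, by positivity, fun N hN hQ1 hPQ hδQ h ↦ ?_⟩
  set L := Real.log N with hL
  set Q := L ^ B with hQ
  set P := L ^ B' with hP
  set δ := P / N with hδ
  have hN0 : (0 : ℝ) < N := by exact_mod_cast (by omega : 0 < N)
  have hL0 : 0 < L := Real.log_pos (by exact_mod_cast (by omega : 1 < N))
  have hQ0 : 0 ≤ Q := by positivity
  have hP0 : 0 ≤ P := by positivity
  have hδ0 : 0 ≤ δ := by positivity
  have hδ1 : δ ≤ 1 := hδQ.trans (by rw [div_le_one (by linarith)]; exact hQ1)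
  -- decompose the integral over the arcs
  rw [integral_majorArcs_eq_sum hQ0 hPQ (continuous_pairIntegrand N h)]
  -- main term arc by arc
  have hmain : ∑ q ∈ Icc 1 ⌊Q⌋₊, ∑ a ∈ (range (q + 1)).filter (fun a : ℕ ↦ a.Coprime q),
      ∫ α in majorArc N q (a : ℤ) P, kernelArcModel 0 N h q a α =
      (∑ q ∈ Icc 1 ⌊Q⌋₊, ((goldbachSeriesTerm h.natAbs q : ℝ) : ℂ)) * truncatedKernelIntegral 0 N h δ := by
    rw [sum_mul]
    refine sum_congr rfl fun q hq ↦ ?_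
    obtain ⟨hq1, hqQ⟩ := mem_Icc.mp hq
    have hqQ' : (q : ℝ) ≤ Q := (Nat.cast_le.mpr hqQ).trans (Nat.floor_le hQ0)
    have hδq : δ ≤ 1 / q :=
      hδQ.trans (one_div_le_one_div_of_le (by exact_mod_cast hq1) hqQ')
    exact sum_integral_kernelArcModel 0 N h hq1 hδ0 hδ1 hδq
  -- error arc by arc
  have herr : ∀ q ∈ Icc 1 ⌊Q⌋₊, ∀ a ∈ (range (q + 1)).filter (fun a : ℕ ↦ a.Coprime q),
      ‖(∫ α in majorArc N q (a : ℤ) P, pairIntegrand N h α) -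
          ∫ α in majorArc N q (a : ℤ) P, kernelArcModel 0 N h q a α‖ ≤
        |C₃| * N ^ 2 * L ^ (-A') * (2 * δ) := by
    intro q hq a ha
    obtain ⟨hq1, hqQ⟩ := mem_Icc.mp hq
    have hqQ' : (q : ℝ) ≤ Q := (Nat.cast_le.mpr hqQ).trans (Nat.floor_le hQ0)
    have hcop : Int.gcd (a : ℤ) q = 1 := by
      rw [Int.gcd_natCast_natCast]; exact (mem_filter.mp ha).2
    rw [← integral_sub ((continuous_pairIntegrand N h).integrableOn_Icc.mono_set fun α hα ↦ hα.1)
      ((continuous_kernelArcModel 0 N h q a).integrableOn_Icc.mono_set fun α hα ↦ hα.1)]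
    have hvol : volume (majorArc N q (a : ℤ) P) < ⊤ :=
      (volume_majorArc_le N q a P).trans_lt ENNReal.ofReal_lt_top
    refine (norm_setIntegral_le_of_norm_le_const (C := |C₃| * N ^ 2 * L ^ (-A')) hvol
      fun α hα ↦ ?_).trans ?_
    · rw [norm_pairIntegrand_sub_kernelArcModel]
      have hβ : |α - (a : ℝ) / q| ≤ L ^ B' / N := by
        have := hα.2; push_cast at this; exact this
      have key := hC₃ N hN q hq1 hqQ' a hcop (α - (a : ℝ) / q) hβ
      have hα' : ((a : ℤ) : ℝ) / q + (α - (a : ℝ) / q) = α := by push_cast; ring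
      rw [hα'] at key
      refine key.trans ?_
      have : 0 ≤ L ^ (-A') := Real.rpow_nonneg hL0.le _
      exact mul_le_mul_of_nonneg_right
        (mul_le_mul_of_nonneg_right (le_abs_self _) (by positivity)) this
    · have : 0 ≤ |C₃| * (N : ℝ) ^ 2 * L ^ (-A') := by
        have : 0 ≤ L ^ (-A') := Real.rpow_nonneg hL0.le _
        positivity
      exact mul_le_mul_of_nonneg_left (volume_real_majorArc_le N q a hδ0) this
  -- sum the errors
  rw [← hmain, ← sum_sub_distrib]
  simp_rw [← sum_sub_distrib]
  calc ‖∑ q ∈ Icc 1 ⌊Q⌋₊, ∑ a ∈ (range (q + 1)).filter (fun a : ℕ ↦ a.Coprime q),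
        ((∫ α in majorArc N q (a : ℤ) P, pairIntegrand N h α) -
          ∫ α in majorArc N q (a : ℤ) P, kernelArcModel 0 N h q a α)‖
      ≤ ∑ q ∈ Icc 1 ⌊Q⌋₊, ∑ a ∈ (range (q + 1)).filter (fun a : ℕ ↦ a.Coprime q),
          ‖(∫ α in majorArc N q (a : ℤ) P, pairIntegrand N h α) -
            ∫ α in majorArc N q (a : ℤ) P, kernelArcModel 0 N h q a α‖ :=
        (norm_sum_le _ _).trans (sum_le_sum fun q _ ↦ norm_sum_le _ _)
    _ ≤ ∑ q ∈ Icc 1 ⌊Q⌋₊, ∑ _a ∈ (range (q + 1)).filter (fun a : ℕ ↦ a.Coprime q),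
          |C₃| * N ^ 2 * L ^ (-A') * (2 * δ) :=
        sum_le_sum fun q hq ↦ sum_le_sum fun a ha ↦ herr q hq a ha
    _ = (majorArcIndex Q).card * (|C₃| * N ^ 2 * L ^ (-A') * (2 * δ)) := by
        rw [majorArcIndex, card_sigma, Nat.cast_sum, sum_mul]
        refine sum_congr rfl fun q _ ↦ ?_
        rw [sum_const, nsmul_eq_mul]
    _ ≤ (2 * Q ^ 2) * (|C₃| * N ^ 2 * L ^ (-A') * (2 * δ)) := by
        have : 0 ≤ L ^ (-A') := Real.rpow_nonneg hL0.le _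
        exact mul_le_mul_of_nonneg_right (card_majorArcIndex_le hQ1) (by positivity)
    _ = 4 * |C₃| * N ^ 2 * L ^ (-A') * (Q ^ 2 * δ) := by ring

/-! ### The estimate for large `N` -/

/-- **Classical major arcs for prime pairs, large `N`** (the computation of Matomäki–Radziwiłł–Tao
2019, pp. 20–21, for the full sum on arcs of levels `P = log^{B'} N`, `Q = log^B N`, assuming
Prop. 4.1): there are `N₀` and `C` with
`|∫_𝔐 |S|² e(αh) dα - 𝔖(h) N| ≤ C d(h)² (N (log^{-B/2} N + log^{-B'} N) + |h|)`
for all `N ≥ N₀` and `0 < |h| ≤ N`. [cite: MatomakiRadziwillTao2019, Prop. 3.3(i) proof, pp. 20–21 (arXiv)] -/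
theorem integral_majorArcs_pairIntegrand_sub_le (h41 : MatomakiRadziwillTao2019_prop41) {B B' : ℝ}
    (hB : 0 < B) (hB' : 0 < B') :
    ∃ N₀ : ℕ, ∃ C : ℝ, 0 ≤ C ∧ ∀ N : ℕ, N₀ ≤ N → ∀ h : ℤ, h ≠ 0 → (|h| : ℝ) ≤ N →
      ‖(∫ α in majorArcs N (Real.log N ^ B') (Real.log N ^ B), pairIntegrand N h α) -
          (goldbachSingularSeries h.natAbs * N : ℂ)‖ ≤
        C * ((Nat.divisors h.natAbs).card : ℝ) ^ 2 *
          (N * (Real.log N ^ (-(B / 2)) + Real.log N ^ (-B')) + |(h : ℝ)|) := by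
  obtain ⟨C₃, hC₃0, hC₃⟩ :=
    integral_majorArcs_pairIntegrand_approx h41 (by linarith : 0 < B + 2 * B + B') hB hB'
  obtain ⟨x₁, hx₁1, hx₁⟩ :=
    exists_log_rpow_le_mul (k := B' + 2 * B) (c := 1 / 4) (by linarith) (by norm_num)
  set K₀ := goldbachWeightConst with hK₀
  have hK₀0 : 0 ≤ K₀ := (Real.exp_pos _).le
  refine ⟨max 4 ⌈x₁⌉₊, C₃ + K₀, by positivity, fun N hN h hh hhN ↦ ?_⟩
  -- basic quantities
  have hN4' : 4 ≤ N := le_of_max_le_left hN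
  have hN4 : (4 : ℝ) ≤ N := by exact_mod_cast hN4'
  have hNx₁ : x₁ ≤ N := (Nat.le_ceil x₁).trans (by exact_mod_cast le_of_max_le_right hN)
  have hN0 : (0 : ℝ) < N := by linarith
  have hN1 : (1 : ℝ) ≤ N := by linarith
  have hN2 : 2 ≤ N := by omega
  set L := Real.log N with hL
  have hL1 : 1 ≤ L := by
    rw [hL, Real.le_log_iff_exp_le hN0]
    exact Real.exp_one_lt_d9.le.trans (by norm_num; linarith)
  have hL0 : 0 < L := by linarith
  have hmono : ∀ s t : ℝ, s ≤ t → L ^ s ≤ L ^ t :=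
    fun s t hst ↦ Real.rpow_le_rpow_of_exponent_le hL1 hst
  set Q := L ^ B with hQ
  set P := L ^ B' with hP
  set δ := P / N with hδ
  have hQ1 : 1 ≤ Q := Real.one_le_rpow hL1 hB.le
  have hQ0 : 0 < Q := by linarith
  have hP0 : 0 < P := Real.rpow_pos_of_pos hL0 _
  have hδ0 : 0 < δ := div_pos hP0 hN0
  -- the large-`N` conditions
  have hbig : L ^ (B' + 2 * B) ≤ N / 4 := by
    have := hx₁ N hNx₁; linarith
  have hPQ2 : P * Q ^ 2 = L ^ (B' + 2 * B) := by
    rw [hP, hQ, ← Real.rpow_natCast, ← Real.rpow_mul hL0.le, ← Real.rpow_add hL0]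
    congr 1
    push_cast
    ring
  have hcond1 : 2 * P * Q ^ 2 < N := by
    rw [mul_assoc, hPQ2]; linarith
  have hcond2 : P / N ≤ 1 / Q := by
    rw [div_le_div_iff₀ hN0 hQ0, one_mul]
    calc P * Q = L ^ (B' + B) := by rw [hP, hQ, ← Real.rpow_add hL0]
      _ ≤ L ^ (B' + 2 * B) := hmono _ _ (by linarith)
      _ ≤ N := by linarith
  have hδhalf : δ ≤ 1 / 2 := by
    rw [hδ, div_le_div_iff₀ hN0 (by norm_num), one_mul]
    have : P ≤ L ^ (B' + 2 * B) := by
      rw [hP]; exact hmono _ _ (by linarith)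
    linarith
  -- Step 1: arcs = main + O(N L^{-B})
  have h1 := hC₃ N hN2 hQ1 hcond1 hcond2 h
  have hLL : L ^ (-(B + 2 * B + B')) * L ^ (B' + 2 * B) = L ^ (-B) := by
    rw [← Real.rpow_add hL0]; congr 1; ring
  have hE1 : C₃ * (N : ℝ) ^ 2 * L ^ (-(B + 2 * B + B')) * (Q ^ 2 * (P / N)) = C₃ * N * L ^ (-B) := by
    calc C₃ * (N : ℝ) ^ 2 * L ^ (-(B + 2 * B + B')) * (Q ^ 2 * (P / N))
        = C₃ * ((N : ℝ) ^ 2 / N) * (L ^ (-(B + 2 * B + B')) * (P * Q ^ 2)) := by ring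
      _ = C₃ * N * L ^ (-B) := by
          rw [hPQ2, hLL, sq, mul_div_assoc, div_self hN0.ne', mul_one]
  rw [hE1] at h1
  -- Step 2: the kernel integral `I_δ = N - |h| + O(N / (2 L^{B'}))`
  have hn : h.natAbs ≠ 0 := Int.natAbs_ne_zero.mpr hh
  have hhNint : |h| ≤ (N : ℤ) - 0 := by
    rw [sub_zero]
    have : ((|h| : ℤ) : ℝ) ≤ (N : ℝ) := by push_cast; exact hhN
    exact_mod_cast this
  have hI := norm_integral_expSumIocSqKernel_sub_le (a := (0 : ℤ)) (b := (N : ℤ)) hhNint hδ0 hδhalf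
  have hcast : (((N : ℤ) - 0 - |h| : ℤ) : ℂ) = (((N : ℝ) - |(h : ℝ)| : ℝ) : ℂ) := by
    rw [← Complex.ofReal_intCast]
    push_cast
    ring
  have hδinv : 1 / (2 * δ) = N / (2 * L ^ B') := by
    rw [hδ, hP]
    field_simp
  rw [hcast, hδinv] at hI
  -- `hI : ‖truncatedKernelIntegral 0 N h δ - ↑(N - |h|)‖ ≤ N / (2 L^{B'})`
  -- Step 3: the singular series partial sum `Σ`
  set Sg := ∑ q ∈ Icc 1 ⌊Q⌋₊, goldbachSeriesTerm h.natAbs q with hSg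
  set d := ((Nat.divisors h.natAbs).card : ℝ) with hd
  have hd1 : 1 ≤ d := by
    rw [hd]; exact_mod_cast Finset.card_pos.mpr ⟨1, Nat.one_mem_divisors.mpr hn⟩
  have hSg_abs : |Sg| ≤ K₀ * d ^ 2 :=
    (abs_sum_le_sum_abs _ _).trans (sum_abs_goldbachSeriesTerm_le hn _)
  have hSg_tail : |goldbachSingularSeries h.natAbs - Sg| ≤ K₀ * d ^ 2 * L ^ (-(B / 2)) := by
    refine (abs_goldbachSingularSeries_sub_sum_le hn hQ1).trans_eq ?_
    rw [div_eq_mul_inv, hQ, Real.sqrt_eq_rpow, ← Real.rpow_mul hL0.le, ← Real.rpow_neg hL0.le]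
    congr 2
    ring
  have hcastSg : (∑ q ∈ Icc 1 ⌊Q⌋₊, ((goldbachSeriesTerm h.natAbs q : ℝ) : ℂ)) = ((Sg : ℝ) : ℂ) := by
    rw [hSg]; push_cast; rfl
  rw [hcastSg] at h1
  -- Step 4: auxiliary bounds
  have hLB' : (N : ℝ) / (2 * L ^ B') ≤ N * L ^ (-B') := by
    have hLBpos : 0 < L ^ B' := Real.rpow_pos_of_pos hL0 _
    rw [Real.rpow_neg hL0.le, div_le_iff₀ (by positivity)]
    calc (N : ℝ) ≤ 2 * N := by linarith
      _ = N * (L ^ B')⁻¹ * (2 * L ^ B') := by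
          field_simp
  have hLBB : L ^ (-B) ≤ L ^ (-(B / 2)) := hmono _ _ (by linarith)
  -- Step 5: the algebraic decomposition and the four bounds
  set I := truncatedKernelIntegral 0 N h δ with hIdef
  set M := ∫ α in majorArcs N (L ^ B') (L ^ B), pairIntegrand N h α with hM
  set SgC : ℂ := ((Sg : ℝ) : ℂ) with hSgC'
  have hSgC : ‖SgC‖ = |Sg| := by rw [hSgC', Complex.norm_real, Real.norm_eq_abs]
  have hT1 : ‖M - SgC * I‖ ≤ C₃ * N * L ^ (-(B / 2)) :=
    h1.trans (mul_le_mul_of_nonneg_left hLBB (by positivity))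
  have hT2 : ‖SgC * (I - (((N : ℝ) - |(h : ℝ)| : ℝ) : ℂ))‖ ≤ K₀ * d ^ 2 * (N * L ^ (-B')) := by
    rw [norm_mul, hSgC]
    exact mul_le_mul hSg_abs (hI.trans hLB') (norm_nonneg _) (by positivity)
  have hT3 : ‖SgC * ((|(h : ℝ)| : ℝ) : ℂ)‖ ≤ K₀ * d ^ 2 * |(h : ℝ)| := by
    rw [norm_mul, hSgC, Complex.norm_real, Real.norm_eq_abs, abs_abs]
    exact mul_le_mul_of_nonneg_right hSg_abs (abs_nonneg _)
  have hT4 : ‖(N : ℂ) * (((Sg - goldbachSingularSeries h.natAbs : ℝ)) : ℂ)‖ ≤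
      N * (K₀ * d ^ 2 * L ^ (-(B / 2))) := by
    rw [norm_mul, Complex.norm_natCast, Complex.norm_real, Real.norm_eq_abs, abs_sub_comm]
    exact mul_le_mul_of_nonneg_left hSg_tail hN0.le
  have hdecomp : M - (goldbachSingularSeries h.natAbs * N : ℂ) =
      (M - SgC * I) + SgC * (I - (((N : ℝ) - |(h : ℝ)| : ℝ) : ℂ)) - SgC * ((|(h : ℝ)| : ℝ) : ℂ) +
        (N : ℂ) * (((Sg - goldbachSingularSeries h.natAbs : ℝ)) : ℂ) := by
    rw [hSgC']; push_cast; ring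
  rw [hdecomp]
  have hsum := calc
    ‖(M - SgC * I) + SgC * (I - (((N : ℝ) - |(h : ℝ)| : ℝ) : ℂ)) - SgC * ((|(h : ℝ)| : ℝ) : ℂ) +
        (N : ℂ) * (((Sg - goldbachSingularSeries h.natAbs : ℝ)) : ℂ)‖
      ≤ ‖(M - SgC * I) + SgC * (I - (((N : ℝ) - |(h : ℝ)| : ℝ) : ℂ)) - SgC * ((|(h : ℝ)| : ℝ) : ℂ)‖ +
        ‖(N : ℂ) * (((Sg - goldbachSingularSeries h.natAbs : ℝ)) : ℂ)‖ := norm_add_le _ _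
    _ ≤ ‖(M - SgC * I) + SgC * (I - (((N : ℝ) - |(h : ℝ)| : ℝ) : ℂ))‖ + ‖SgC * ((|(h : ℝ)| : ℝ) : ℂ)‖ +
        ‖(N : ℂ) * (((Sg - goldbachSingularSeries h.natAbs : ℝ)) : ℂ)‖ := by
        gcongr; exact norm_sub_le _ _
    _ ≤ ‖M - SgC * I‖ + ‖SgC * (I - (((N : ℝ) - |(h : ℝ)| : ℝ) : ℂ))‖ + ‖SgC * ((|(h : ℝ)| : ℝ) : ℂ)‖ +
        ‖(N : ℂ) * (((Sg - goldbachSingularSeries h.natAbs : ℝ)) : ℂ)‖ := by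
        gcongr; exact norm_add_le _ _
    _ ≤ C₃ * N * L ^ (-(B / 2)) + K₀ * d ^ 2 * (N * L ^ (-B')) + K₀ * d ^ 2 * |(h : ℝ)| +
        N * (K₀ * d ^ 2 * L ^ (-(B / 2))) := add_le_add (add_le_add (add_le_add hT1 hT2) hT3) hT4
    _ = C₃ * (N * L ^ (-(B / 2))) +
        K₀ * d ^ 2 * (N * (L ^ (-(B / 2)) + L ^ (-B')) + |(h : ℝ)|) := by ring
  refine hsum.trans ?_
  have hLB2 : 0 ≤ L ^ (-(B / 2)) := Real.rpow_nonneg hL0.le _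
  have hLB3 : 0 ≤ L ^ (-B') := Real.rpow_nonneg hL0.le _
  have hbig0 : 0 ≤ (N : ℝ) * (L ^ (-(B / 2)) + L ^ (-B')) + |(h : ℝ)| := by positivity
  have hd2 : 1 ≤ d ^ 2 := one_le_pow₀ hd1
  have hfirst : C₃ * ((N : ℝ) * L ^ (-(B / 2))) ≤
      C₃ * d ^ 2 * ((N : ℝ) * (L ^ (-(B / 2)) + L ^ (-B')) + |(h : ℝ)|) := by
    calc C₃ * ((N : ℝ) * L ^ (-(B / 2))) ≤ C₃ * ((N : ℝ) * (L ^ (-(B / 2)) + L ^ (-B')) + |(h : ℝ)|) := by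
          refine mul_le_mul_of_nonneg_left ?_ hC₃0
          nlinarith [abs_nonneg (h : ℝ), mul_nonneg hN0.le hLB3]
      _ = C₃ * 1 * ((N : ℝ) * (L ^ (-(B / 2)) + L ^ (-B')) + |(h : ℝ)|) := by rw [mul_one]
      _ ≤ C₃ * d ^ 2 * ((N : ℝ) * (L ^ (-(B / 2)) + L ^ (-B')) + |(h : ℝ)|) := by gcongr
  calc C₃ * ((N : ℝ) * L ^ (-(B / 2))) + K₀ * d ^ 2 * ((N : ℝ) * (L ^ (-(B / 2)) + L ^ (-B')) + |(h : ℝ)|)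
      ≤ C₃ * d ^ 2 * ((N : ℝ) * (L ^ (-(B / 2)) + L ^ (-B')) + |(h : ℝ)|) +
          K₀ * d ^ 2 * ((N : ℝ) * (L ^ (-(B / 2)) + L ^ (-B')) + |(h : ℝ)|) := by gcongr
    _ = (C₃ + K₀) * d ^ 2 * ((N : ℝ) * (L ^ (-(B / 2)) + L ^ (-B')) + |(h : ℝ)|) := by ring

end PrimePairMajorArcsClassical

open PrimePairMajorArcsClassical

/-! ### The classical major-arc evaluation for prime pairs -/

/-- **Classical major arcs for prime pairs, levels `P = log^{B'} N`, `Q = log^B N`** (the routine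
major-arc computation of the Hardy–Littlewood method for `∑ Λ(n)Λ(n+h)`, as in Matomäki–Radziwiłł–Tao
2019, pp. 20–21, but for the full sum `S(α) = ∑_{n ≤ N} Λ(n) e(nα)` and without the constraint
`B' ≥ 2B + A` of Prop. 3.3(i)), assuming MRT Prop. 4.1: for `B, B' > 0` there are `N₀`, `C ≥ 0` with
`|∫_{𝔐(N; log^{B'} N, log^B N)} |S(α)|² e(αh) dα − 𝔖(h) N| ≤ C d(h)² (N (log^{-B/2} N + log^{-B'} N) + |h|)`
for all `N ≥ N₀` and all `0 < |h| ≤ N`; `𝔐 = Literature.majorArcs`, `𝔖(h) = Literature.goldbachSingularSeries |h|`.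
[cite: MatomakiRadziwillTao2019, Prop. 3.3(i) proof, pp. 20–21 (arXiv)] -/
theorem primePairMajorArcs_logPow_of_prop41 (h41 : MatomakiRadziwillTao2019_prop41) {B B' : ℝ}
    (hB : 0 < B) (hB' : 0 < B') :
    ∃ N₀ : ℕ, ∃ C : ℝ, 0 ≤ C ∧ ∀ N : ℕ, N₀ ≤ N → ∀ h : ℤ, h ≠ 0 → (|h| : ℝ) ≤ N →
      ‖(∫ α in majorArcs N (Real.log N ^ B') (Real.log N ^ B),
            ((‖primeExpSum N α‖ ^ 2 : ℝ) : ℂ) * (𝐞 (α * h) : ℂ)) -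
          (goldbachSingularSeries h.natAbs * N : ℂ)‖ ≤
        C * ((Nat.divisors h.natAbs).card : ℝ) ^ 2 *
          (N * (Real.log N ^ (-(B / 2)) + Real.log N ^ (-B')) + |(h : ℝ)|) :=
  integral_majorArcs_pairIntegrand_sub_le h41 hB hB'

/-- **Classical major arcs for prime pairs, level `P = Q = log^B N`** (Vaughan §3.1's arcs;
Nathanson §8.3's `𝔐` with `Q = (log N)^B`), assuming MRT Prop. 4.1: for `B > 0` there are `N₀`,
`C ≥ 0` with
`|∫_{𝔐(N; log^B N, log^B N)} |S(α)|² e(αh) dα − 𝔖(h) N| ≤ C d(h)² (N log^{-B/2} N + |h|)`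
for all `N ≥ N₀` and `0 < |h| ≤ N`. [cite: MatomakiRadziwillTao2019, Prop. 3.3(i) proof, pp. 20–21 (arXiv)] -/
theorem primePairMajorArcs_classical_of_prop41 (h41 : MatomakiRadziwillTao2019_prop41) {B : ℝ}
    (hB : 0 < B) :
    ∃ N₀ : ℕ, ∃ C : ℝ, 0 ≤ C ∧ ∀ N : ℕ, N₀ ≤ N → ∀ h : ℤ, h ≠ 0 → (|h| : ℝ) ≤ N →
      ‖(∫ α in majorArcs N (Real.log N ^ B) (Real.log N ^ B),
            ((‖primeExpSum N α‖ ^ 2 : ℝ) : ℂ) * (𝐞 (α * h) : ℂ)) -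
          (goldbachSingularSeries h.natAbs * N : ℂ)‖ ≤
        C * ((Nat.divisors h.natAbs).card : ℝ) ^ 2 * (N * Real.log N ^ (-(B / 2)) + |(h : ℝ)|) := by
  obtain ⟨N₀, C, hC0, hC⟩ := primePairMajorArcs_logPow_of_prop41 h41 hB hB
  refine ⟨max N₀ 3, 2 * C, by positivity, fun N hN h hh hhN ↦ ?_⟩
  have hN₀ : N₀ ≤ N := le_of_max_le_left hN
  have hN3 : (3 : ℝ) ≤ N := by exact_mod_cast le_of_max_le_right hN
  have hL1 : 1 ≤ Real.log N := by
    rw [Real.le_log_iff_exp_le (by linarith)]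
    exact Real.exp_one_lt_d9.le.trans (by norm_num; linarith)
  have hmono : Real.log N ^ (-B) ≤ Real.log N ^ (-(B / 2)) :=
    Real.rpow_le_rpow_of_exponent_le hL1 (by linarith)
  have hL0 : 0 ≤ Real.log N ^ (-(B / 2)) := Real.rpow_nonneg (by linarith) _
  refine (hC N hN₀ h hh hhN).trans ?_
  have hd : 0 ≤ C * ((Nat.divisors h.natAbs).card : ℝ) ^ 2 := by positivity
  calc C * ((Nat.divisors h.natAbs).card : ℝ) ^ 2 *
        (N * (Real.log N ^ (-(B / 2)) + Real.log N ^ (-B)) + |(h : ℝ)|)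
      ≤ C * ((Nat.divisors h.natAbs).card : ℝ) ^ 2 *
        (2 * (N * Real.log N ^ (-(B / 2)) + |(h : ℝ)|)) := by
        refine mul_le_mul_of_nonneg_left ?_ hd
        nlinarith [abs_nonneg (h : ℝ), mul_le_mul_of_nonneg_left hmono (by positivity : (0 : ℝ) ≤ N)]
    _ = 2 * C * ((Nat.divisors h.natAbs).card : ℝ) ^ 2 * (N * Real.log N ^ (-(B / 2)) + |(h : ℝ)|) := by
        ring

/-- **Classical major arcs for prime pairs, qualitative form**: assuming MRT Prop. 4.1, for every
fixed shift `h ≠ 0`, every `B > 0` and every `ε > 0`,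
`|∫_{𝔐(N; log^B N, log^B N)} |S(α)|² e(αh) dα − 𝔖(h) N| ≤ ε N` for all large `N` (so with
`𝔖({0,2}) = 𝔖(2)`, `Literature.NumberTheory.Sieve.singularSeries_pair_holds`/`Literature.goldbachSingularSeries_two`, the case `h = ∓2`
is the major-arc input of the twin-prime instance of the circle method).
[cite: MatomakiRadziwillTao2019, Prop. 3.3(i) proof, pp. 20–21 (arXiv)] -/
theorem primePairMajorArcs_classical_eps_of_prop41 (h41 : MatomakiRadziwillTao2019_prop41)
    (h : ℤ) (hh : h ≠ 0) {B : ℝ} (hB : 0 < B) {ε : ℝ} (hε : 0 < ε) :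
    ∃ N₀ : ℕ, ∀ N : ℕ, N₀ ≤ N →
      ‖(∫ α in majorArcs N (Real.log N ^ B) (Real.log N ^ B),
            ((‖primeExpSum N α‖ ^ 2 : ℝ) : ℂ) * (𝐞 (α * h) : ℂ)) -
          (goldbachSingularSeries h.natAbs * N : ℂ)‖ ≤ ε * N := by
  obtain ⟨N₀, C, hC0, hC⟩ := primePairMajorArcs_classical_of_prop41 h41 hB
  set d := ((Nat.divisors h.natAbs).card : ℝ) with hd
  -- `M = 2 C d² / ε` (at least `1`); we need `log^{B/2} N ≥ M` and `N ≥ M |h|`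
  set M : ℝ := max 1 (2 * C * d ^ 2 / ε) with hM
  have hM1 : 1 ≤ M := le_max_left _ _
  have hM0 : 0 < M := by linarith
  have hMε : 2 * C * d ^ 2 / ε ≤ M := le_max_right _ _
  have hCd : C * d ^ 2 ≤ M * ε / 2 := by
    rw [div_le_iff₀ hε] at hMε; linarith
  refine ⟨max (max N₀ h.natAbs) (max ⌈Real.exp (M ^ (2 / B))⌉₊ ⌈M * |(h : ℝ)|⌉₊), fun N hN ↦ ?_⟩
  have hN₀ : N₀ ≤ N := (le_max_left _ _).trans ((le_max_left _ _).trans hN)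
  have hhN' : h.natAbs ≤ N := (le_max_right _ _).trans ((le_max_left _ _).trans hN)
  have hhN : (|h| : ℝ) ≤ N := by
    rw [← Int.cast_abs, Int.abs_eq_natAbs]; exact_mod_cast hhN'
  have hNexp : Real.exp (M ^ (2 / B)) ≤ N :=
    (Nat.le_ceil _).trans (by exact_mod_cast (le_max_left _ _).trans ((le_max_right _ _).trans hN))
  have hNh : M * |(h : ℝ)| ≤ N :=
    (Nat.le_ceil _).trans (by exact_mod_cast (le_max_right _ _).trans ((le_max_right _ _).trans hN))
  have hN0 : (0 : ℝ) < N := (Real.exp_pos _).trans_le hNexp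
  -- `log^{B/2} N ≥ M`
  have hlog : M ^ (2 / B) ≤ Real.log N := by
    rw [Real.le_log_iff_exp_le hN0]; exact hNexp
  have hL0 : 0 < Real.log N := (Real.rpow_pos_of_pos hM0 _).trans_le hlog
  have hLM : M ≤ Real.log N ^ (B / 2) := by
    calc M = (M ^ (2 / B)) ^ (B / 2) := by
          rw [← Real.rpow_mul hM0.le]
          field_simp [hB.ne']
          exact (Real.rpow_one M).symm
      _ ≤ Real.log N ^ (B / 2) := Real.rpow_le_rpow (Real.rpow_nonneg hM0.le _) hlog (by linarith)
  have hLBpos : 0 < Real.log N ^ (B / 2) := Real.rpow_pos_of_pos hL0 _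
  refine (hC N hN₀ h hh hhN).trans ?_
  -- `C d² N log^{-B/2} N ≤ C d² N / M ≤ ε N / 2` and `C d² |h| ≤ (Mε/2)|h| ≤ ε N / 2`
  have h1 : C * d ^ 2 * (N * Real.log N ^ (-(B / 2))) ≤ ε * N / 2 := by
    rw [Real.rpow_neg hL0.le]
    calc C * d ^ 2 * (N * (Real.log N ^ (B / 2))⁻¹) ≤ (M * ε / 2) * (N * M⁻¹) := by
          gcongr
      _ = ε * N / 2 := by field_simp
  have h2 : C * d ^ 2 * |(h : ℝ)| ≤ ε * N / 2 := by
    calc C * d ^ 2 * |(h : ℝ)| ≤ (M * ε / 2) * |(h : ℝ)| :=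
          mul_le_mul_of_nonneg_right hCd (abs_nonneg _)
      _ = ε / 2 * (M * |(h : ℝ)|) := by ring
      _ ≤ ε / 2 * N := mul_le_mul_of_nonneg_left hNh (by positivity)
      _ = ε * N / 2 := by ring
  calc C * d ^ 2 * (N * Real.log N ^ (-(B / 2)) + |(h : ℝ)|)
      = C * d ^ 2 * (N * Real.log N ^ (-(B / 2))) + C * d ^ 2 * |(h : ℝ)| := by ring
    _ ≤ ε * N / 2 + ε * N / 2 := add_le_add h1 h2
    _ = ε * N := by ring

/-- The qualitative form with the integrand written `S(α) conj(S(α)) e(αh)` (the shape produced by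
expanding `|S|²` through orthogonality, cf. `Literature.NumberTheory.Sieve.weightedGoldbachCount_eq_integral`). [folklore] -/
theorem primePairMajorArcs_classical_eps_conj_of_prop41 (h41 : MatomakiRadziwillTao2019_prop41)
    (h : ℤ) (hh : h ≠ 0) {B : ℝ} (hB : 0 < B) {ε : ℝ} (hε : 0 < ε) :
    ∃ N₀ : ℕ, ∀ N : ℕ, N₀ ≤ N →
      ‖(∫ α in majorArcs N (Real.log N ^ B) (Real.log N ^ B),
            (primeExpSum N α * (starRingEnd ℂ) (primeExpSum N α)) * (𝐞 (α * h) : ℂ)) -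
          (goldbachSingularSeries h.natAbs * N : ℂ)‖ ≤ ε * N := by
  simp_rw [primeExpSum_mul_conj]
  exact primePairMajorArcs_classical_eps_of_prop41 h41 h hh hB hε

/-! ### The same statements from the Siegel–Walfisz theorem -/

/-- `primePairMajorArcs_logPow_of_prop41` from the Siegel–Walfisz theorem (parity.S28), through
`Literature.NumberTheory.Sieve.MatomakiRadziwillTao2019_prop41_of_siegelWalfisz`. [cite: MatomakiRadziwillTao2019, Prop. 3.3(i) proof, pp. 20–21 (arXiv)] -/
theorem primePairMajorArcs_logPow_of_siegelWalfisz (hSW : Literature.NumberTheory.Sieve.siegel_walfisz) {B B' : ℝ}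
    (hB : 0 < B) (hB' : 0 < B') :
    ∃ N₀ : ℕ, ∃ C : ℝ, 0 ≤ C ∧ ∀ N : ℕ, N₀ ≤ N → ∀ h : ℤ, h ≠ 0 → (|h| : ℝ) ≤ N →
      ‖(∫ α in majorArcs N (Real.log N ^ B') (Real.log N ^ B),
            ((‖primeExpSum N α‖ ^ 2 : ℝ) : ℂ) * (𝐞 (α * h) : ℂ)) -
          (goldbachSingularSeries h.natAbs * N : ℂ)‖ ≤
        C * ((Nat.divisors h.natAbs).card : ℝ) ^ 2 *
          (N * (Real.log N ^ (-(B / 2)) + Real.log N ^ (-B')) + |(h : ℝ)|) :=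
  primePairMajorArcs_logPow_of_prop41 (MatomakiRadziwillTao2019_prop41_of_siegelWalfisz hSW) hB hB'

/-- `primePairMajorArcs_classical_of_prop41` from the Siegel–Walfisz theorem (parity.S28).
[cite: MatomakiRadziwillTao2019, Prop. 3.3(i) proof, pp. 20–21 (arXiv)] -/
theorem primePairMajorArcs_classical_of_siegelWalfisz (hSW : Literature.NumberTheory.Sieve.siegel_walfisz) {B : ℝ}
    (hB : 0 < B) :
    ∃ N₀ : ℕ, ∃ C : ℝ, 0 ≤ C ∧ ∀ N : ℕ, N₀ ≤ N → ∀ h : ℤ, h ≠ 0 → (|h| : ℝ) ≤ N →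
      ‖(∫ α in majorArcs N (Real.log N ^ B) (Real.log N ^ B),
            ((‖primeExpSum N α‖ ^ 2 : ℝ) : ℂ) * (𝐞 (α * h) : ℂ)) -
          (goldbachSingularSeries h.natAbs * N : ℂ)‖ ≤
        C * ((Nat.divisors h.natAbs).card : ℝ) ^ 2 * (N * Real.log N ^ (-(B / 2)) + |(h : ℝ)|) :=
  primePairMajorArcs_classical_of_prop41 (MatomakiRadziwillTao2019_prop41_of_siegelWalfisz hSW) hB

/-- `primePairMajorArcs_classical_eps_of_prop41` from the Siegel–Walfisz theorem (parity.S28).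
[cite: MatomakiRadziwillTao2019, Prop. 3.3(i) proof, pp. 20–21 (arXiv)] -/
theorem primePairMajorArcs_classical_eps_of_siegelWalfisz (hSW : Literature.NumberTheory.Sieve.siegel_walfisz)
    (h : ℤ) (hh : h ≠ 0) {B : ℝ} (hB : 0 < B) {ε : ℝ} (hε : 0 < ε) :
    ∃ N₀ : ℕ, ∀ N : ℕ, N₀ ≤ N →
      ‖(∫ α in majorArcs N (Real.log N ^ B) (Real.log N ^ B),
            ((‖primeExpSum N α‖ ^ 2 : ℝ) : ℂ) * (𝐞 (α * h) : ℂ)) -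
          (goldbachSingularSeries h.natAbs * N : ℂ)‖ ≤ ε * N :=
  primePairMajorArcs_classical_eps_of_prop41 (MatomakiRadziwillTao2019_prop41_of_siegelWalfisz hSW)
    h hh hB hε

/-- `primePairMajorArcs_classical_eps_conj_of_prop41` from the Siegel–Walfisz theorem (parity.S28).
[folklore] -/
theorem primePairMajorArcs_classical_eps_conj_of_siegelWalfisz (hSW : Literature.NumberTheory.Sieve.siegel_walfisz)
    (h : ℤ) (hh : h ≠ 0) {B : ℝ} (hB : 0 < B) {ε : ℝ} (hε : 0 < ε) :
    ∃ N₀ : ℕ, ∀ N : ℕ, N₀ ≤ N →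
      ‖(∫ α in majorArcs N (Real.log N ^ B) (Real.log N ^ B),
            (primeExpSum N α * (starRingEnd ℂ) (primeExpSum N α)) * (𝐞 (α * h) : ℂ)) -
          (goldbachSingularSeries h.natAbs * N : ℂ)‖ ≤ ε * N :=
  primePairMajorArcs_classical_eps_conj_of_prop41
    (MatomakiRadziwillTao2019_prop41_of_siegelWalfisz hSW) h hh hB hε

end Literature.NumberTheory.Sieve

end
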